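import Summits.RiemannHypothesis.RiemannHypothesis.Theorems.HandoffBottomGrowth
import Summits.RiemannHypothesis.RiemannHypothesis.Theorems.HandoffBottomDischarge
import HarnessLib

/-!
# The graded bottom-growth tier made UNCONDITIONAL, and the lossy tier WITHOUT A RUNG

Cell `rh-explicit`, TRACK «HANDOFF», seat handoff-theory-1 (definitions + logic), gen4 — appendix to `HandoffBottomGrowth.lean`
(file VI: the graded Prop `WeilBottomExpDropOfZero`, growth classes `WeilBottomGrowthLE α`, the graded door) and `HandoffBottomDischarge.lean`
(file VII: the track's criterion and Lemma L are TREE theorems — Solo programme `SoloInformedQuasiWeil*.lean`, route WeilGroundState).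
Companion text: `HOME/handoff/HANDOFF-STATEMENT.md` §J.10.

CONTENT (bridges and bookkeeping only; every analytic input is a tree theorem):
* §1 `weilBottomExpDropOfZero_holds` — the graded Prop of file VI HOLDS (`weilBottomExpDrop_of_zero`, file VII, from the Solo programme's
  `frequently_weilGroundEnergy_lt_of_offline_zero`); hence every CONDITIONAL theorem of file VI is unconditional:
  `WeilBottomGrowthLE α ⟹ QuasiRiemannHypothesis (½ + α)`, `RH ↔ WeilBottomGrowthLE 0 ↔ ∀ α > 0, WeilBottomGrowthLE α`, a zero `ρ` forbids every growth
  class below `Re ρ − ½`, power-bounded accumulated loss `≤ D·Q^a` ⟹ zero-free half-plane `Re s > ½ + a`, sub-power loss ⟹ RH.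
* §2 the unconditional end of the scale: `WeilBottomGrowthLE α` holds for every `α > ½` (the Solo floor `ε(a) ≥ −C(1+a)e^{a}`), matching the vacuous
  `QuasiRiemannHypothesis 1` — the graded door has content exactly for `a < ½`.
* §3 **NO RUNG NEEDED for the lossy tier**: the rung hypothesis `−ℓ₀ ≤ ε((log q₀)/2)` of files II/VI/VII is always met by the ACTUAL value
  `ℓ₀ := max 0 (−ε((log q₀)/2))`, so the TAIL form alone decides: `(∀ primes q ≥ q₀, StepLossy(q, δ_q)) ∧ Σδ ≤ D ⟹ RH`
  (`riemannHypothesis_of_tail_stepLossy`), `… ∧ Σ_{<Q}δ ≤ D·Q^a ⟹ QuasiRiemannHypothesis (½ + a)` (`quasiRiemannHypothesis_of_tail_stepLossy`),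
  in particular `RH ↔ ∃ prime q₀, ∀ primes q ≥ q₀, StepLossy(q, 0)` (`riemannHypothesis_iff_tail_stepLossy_zero`) and, under `¬RH`, `StepLossy(q, 0)`
  FAILS for infinitely many primes (`exists_not_handoffStepLossy_zero_of_not_riemannHypothesis`) — referee r5 HS-5 settled as a theorem.  So the HYBRID
  contract of `HandoffHybridTarget.lean` (certified rung ∧ tail from the SAME `q₀`) is needed exactly for the LOSSLESS increment `HandoffStep` (vacuous past a
  failure) and for effective constants, not for the logic of the lossy tier.

HONEST FRAMING.  Nothing here is a step towards RH; no RH-free mechanism for a summable or power-saving loss is claimed (HANDOFF-STATEMENT §J.3/§J.10 (7):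
the unconditional rate is the Vinogradov–Korobov `e^{a − a^θ}`, `SoloInformedQuasiWeilVK.lean`; the trivial per-prime modulus accumulates to `≍ √Q`).

References: Bombieri 2000 Thm. 1–2, §4 [Bombieri2000Weil]; this track HANDOFF-STATEMENT §J; tree `SoloInformedQuasiWeilCriterion.lean`.
-/

set_option linter.dupNamespace false  -- the mandated namespace repeats `RiemannHypothesis`

noncomputable section

open Set Filter Literature.NumberTheory.LFunctions

namespace Summit.RiemannHypothesis.RiemannHypothesis.Theorems.HandoffDecomposition

variable {α : ℝ}

/-! ## §1  The graded Prop holds; file VI unconditionally -/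

/-- **The graded Lemma L HOLDS** (file VI's `WeilBottomExpDropOfZero`), by file VII's `weilBottomExpDrop_of_zero` (tree: Solo programme).
[tree SoloInformedQuasiWeilCriterion; this track (theory-1 gen4)] -/
theorem weilBottomExpDropOfZero_holds : WeilBottomExpDropOfZero :=
  fun ρ hρ a ha h1 h2 C T ↦ weilBottomExpDrop_of_zero ρ hρ a ha h1 h2 C T

/-- **Growth rate `α ≥ 0` ⟹ zero-free half-plane `Re s > ½ + α`**, unconditionally. [tree; this track (theory-1 gen4)] -/
theorem quasiRiemannHypothesis_of_weilBottomGrowthLE' (hα : 0 ≤ α) (h : WeilBottomGrowthLE α) :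
    QuasiRiemannHypothesis (1 / 2 + α) :=
  quasiRiemannHypothesis_of_weilBottomGrowthLE weilBottomExpDropOfZero_holds hα h

/-- **`RH ↔ WeilBottomGrowthLE 0`** (the bottom eventually bounded below), unconditionally. [tree; this track (theory-1 gen4)] -/
theorem riemannHypothesis_iff_weilBottomGrowthLE_zero' : Summit.RiemannHypothesis ↔ WeilBottomGrowthLE 0 :=
  riemannHypothesis_iff_weilBottomGrowthLE_zero weilBottomExpDropOfZero_holds

/-- **`RH ↔ ∀ α > 0, WeilBottomGrowthLE α`** (sub-exponential growth of the negative part), unconditionally. [tree; this track (theory-1 gen4)] -/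
theorem riemannHypothesis_iff_forall_weilBottomGrowthLE' :
    Summit.RiemannHypothesis ↔ ∀ α : ℝ, 0 < α → WeilBottomGrowthLE α :=
  riemannHypothesis_iff_forall_weilBottomGrowthLE weilBottomExpDropOfZero_holds

/-- **A zero forbids every growth class below its excess** (`θ_drop ≥ Re ρ − ½`), unconditionally. [tree; this track (theory-1 gen4)] -/
theorem not_weilBottomGrowthLE_of_zero' {ρ : ℂ} (hρ : riemannZeta ρ = 0) {a : ℝ} (ha : 0 ≤ a) (ha' : a < ρ.re - 1 / 2) :
    ¬ WeilBottomGrowthLE a :=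
  not_weilBottomGrowthLE_of_zero weilBottomExpDropOfZero_holds hρ ha ha'

/-- **THE GRADED DOOR, unconditionally in its bridge**: rung with loss at a prime `q₀` ∧ `StepLossy(q, δ_q)` for all primes `q ≥ q₀` ∧
`Σ_{q₀≤p<Q} δ_p ≤ D·Q^a` (`0 ≤ a`, `0 ≤ D`) ⟹ `QuasiRiemannHypothesis (½ + a)`. [tree; this track (theory-1 gen4)] -/
theorem quasiRiemannHypothesis_of_powerBounded_loss' {δ : ℕ → ℝ} {q₀ : ℕ} {ℓ₀ D a : ℝ} (hq₀ : q₀.Prime) (hℓ₀ : 0 ≤ ℓ₀)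
    (hδ : ∀ q : ℕ, q.Prime → 0 ≤ δ q) (hr : -ℓ₀ ≤ weilGroundEnergy (Real.log q₀ / 2))
    (h : ∀ q : ℕ, q.Prime → q₀ ≤ q → HandoffStepLossy q (δ q)) (ha : 0 ≤ a) (hD0 : 0 ≤ D)
    (hD : ∀ Q : ℕ, ∑ p ∈ (Finset.Ico q₀ Q).filter Nat.Prime, δ p ≤ D * (Q : ℝ) ^ a) :
    QuasiRiemannHypothesis (1 / 2 + a) :=
  quasiRiemannHypothesis_of_powerBounded_loss weilBottomExpDropOfZero_holds hq₀ hℓ₀ hδ hr h ha hD0 hD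

/-- **Sub-power accumulated loss ⟹ RH**, unconditionally in its bridge. [tree; this track (theory-1 gen4)] -/
theorem riemannHypothesis_of_subpower_loss' {δ : ℕ → ℝ} {q₀ : ℕ} {ℓ₀ : ℝ} (hq₀ : q₀.Prime) (hℓ₀ : 0 ≤ ℓ₀)
    (hδ : ∀ q : ℕ, q.Prime → 0 ≤ δ q) (hr : -ℓ₀ ≤ weilGroundEnergy (Real.log q₀ / 2))
    (h : ∀ q : ℕ, q.Prime → q₀ ≤ q → HandoffStepLossy q (δ q))
    (hD : ∀ a : ℝ, 0 < a → ∃ D : ℝ, 0 ≤ D ∧ ∀ Q : ℕ, ∑ p ∈ (Finset.Ico q₀ Q).filter Nat.Prime, δ p ≤ D * (Q : ℝ) ^ a) :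
    Summit.RiemannHypothesis :=
  riemannHypothesis_of_subpower_loss weilBottomExpDropOfZero_holds hq₀ hℓ₀ hδ hr h hD

/-! ## §2  The unconditional end of the scale -/

/-- **Every rate `α > ½` holds unconditionally** (the Solo floor `ε(a) ≥ −C_κ e^{κa}` for `κ > 1`, i.e. Bombieri's a-priori bound): the graded door has
content exactly for `a < ½`, matching the vacuous `QuasiRiemannHypothesis 1`. [tree SoloInformedQuasiWeilCriterion (`weilGroundEnergy_exp_lower_of_one_lt`)] -/
theorem weilBottomGrowthLE_of_half_lt (hα : 1 / 2 < α) : WeilBottomGrowthLE α := by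
  obtain ⟨C, hC⟩ := Theorems.weilGroundEnergy_exp_lower_of_one_lt (κ := 2 * α) (by linarith)
  refine ⟨C, 1, fun t ht ↦ ?_⟩
  have := hC t (lt_of_lt_of_le one_pos ht)
  have e : -(C * Real.exp (2 * α * t)) = -C * Real.exp (2 * α * t) := by ring
  rwa [e] at this

/-! ## §3  No rung needed: the tail of the lossy increment decides -/

/-- The rung-with-loss hypothesis is always met by the actual value `ℓ₀ := max 0 (−ε((log q₀)/2))`. [folklore] -/
theorem neg_max_neg_le_weilGroundEnergy (t : ℝ) : -(max 0 (-weilGroundEnergy t)) ≤ weilGroundEnergy t := by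
  have := le_max_right 0 (-weilGroundEnergy t)
  linarith

/-- **TAIL OF THE LOSSY INCREMENT WITH BOUNDED TOTAL LOSS ⟹ RH — no rung hypothesis**: if `StepLossy(q, δ_q)` (`δ ≥ 0`) holds for all primes
`q ≥ q₀` (`q₀` prime) and the partial loss sums from `q₀` are `≤ D`, then RH (telescope from the actual bottom at `q₀`; the bottom is then bounded
below; tree criterion). [this track (theory-1 gen4); tree] -/
theorem riemannHypothesis_of_tail_stepLossy {δ : ℕ → ℝ} {q₀ : ℕ} {D : ℝ} (hq₀ : q₀.Prime)
    (hδ : ∀ q : ℕ, q.Prime → 0 ≤ δ q) (h : ∀ q : ℕ, q.Prime → q₀ ≤ q → HandoffStepLossy q (δ q))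
    (hD : ∀ Q : ℕ, ∑ p ∈ (Finset.Ico q₀ Q).filter Nat.Prime, δ p ≤ D) : Summit.RiemannHypothesis :=
  riemannHypothesis_of_bounded_loss' hq₀ (le_max_left 0 _) hδ (neg_max_neg_le_weilGroundEnergy _) h hD

/-- **TAIL OF THE LOSSY INCREMENT WITH POWER-BOUNDED LOSS ⟹ a zero-free half-plane — no rung hypothesis.** [this track (theory-1 gen4); tree] -/
theorem quasiRiemannHypothesis_of_tail_stepLossy {δ : ℕ → ℝ} {q₀ : ℕ} {D a : ℝ} (hq₀ : q₀.Prime)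
    (hδ : ∀ q : ℕ, q.Prime → 0 ≤ δ q) (h : ∀ q : ℕ, q.Prime → q₀ ≤ q → HandoffStepLossy q (δ q)) (ha : 0 ≤ a)
    (hD0 : 0 ≤ D) (hD : ∀ Q : ℕ, ∑ p ∈ (Finset.Ico q₀ Q).filter Nat.Prime, δ p ≤ D * (Q : ℝ) ^ a) :
    QuasiRiemannHypothesis (1 / 2 + a) :=
  quasiRiemannHypothesis_of_powerBounded_loss' hq₀ (le_max_left 0 _) hδ (neg_max_neg_le_weilGroundEnergy _) h ha hD0 hD

/-- **The lossless lossy increment in tail form is RH by itself**: `(∀ primes q ≥ q₀, StepLossy(q, 0)) ⟹ RH` for any prime `q₀` — no certified rung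
(contrast `HandoffStep`, whose tail is vacuous, `exists_forall_handoffStep`). [this track (theory-1 gen4); tree] -/
theorem riemannHypothesis_of_tail_stepLossy_zero {q₀ : ℕ} (hq₀ : q₀.Prime)
    (h : ∀ q : ℕ, q.Prime → q₀ ≤ q → HandoffStepLossy q 0) : Summit.RiemannHypothesis :=
  riemannHypothesis_of_tail_stepLossy (δ := fun _ ↦ 0) (D := 0) hq₀ (fun _ _ ↦ le_rfl) h (fun _ ↦ by simp)

/-- **`RH ↔` the zero-loss lossy increment holds for all large primes.** [this track (theory-1 gen4); tree] -/
theorem riemannHypothesis_iff_tail_stepLossy_zero :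
    Summit.RiemannHypothesis ↔ ∃ q₀ : ℕ, q₀.Prime ∧ ∀ q : ℕ, q.Prime → q₀ ≤ q → HandoffStepLossy q 0 :=
  ⟨fun hRH ↦ ⟨2, Nat.prime_two, fun q _ _ ↦ handoffStepLossy_of_riemannHypothesis hRH q le_rfl⟩,
    fun ⟨_, hq₀, h⟩ ↦ riemannHypothesis_of_tail_stepLossy_zero hq₀ h⟩

/-- **Under `¬RH`, `StepLossy(q, 0)` fails for infinitely many primes** — i.e. `ε((log q⁺)/2) < min(ε((log q)/2), 0)`: the negative part of the bottom
keeps growing strictly across prime windows (referee r5 HS-5, as a theorem). [this track (theory-1 gen4); tree] -/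
theorem exists_not_handoffStepLossy_zero_of_not_riemannHypothesis (hRH : ¬ Summit.RiemannHypothesis) (N : ℕ) :
    ∃ q : ℕ, q.Prime ∧ N ≤ q ∧ ¬ HandoffStepLossy q 0 := by
  by_contra hnone
  push Not at hnone
  obtain ⟨p, hNp, hp⟩ := Nat.exists_infinite_primes N
  exact hRH (riemannHypothesis_of_tail_stepLossy_zero hp fun q hq hpq ↦ hnone q hq (hNp.trans hpq))

end Summit.RiemannHypothesis.RiemannHypothesis.Theorems.HandoffDecomposition

end
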